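import Summits.HodgeConjecture.HodgeConjecture.Theorems.Ring2HypothesesDescentAbsoluteExteriorLefschetzH1
import Literature.AlgebraicGeometry.Milne1999.HodgeGroupPowersDiagonal
import HarnessLib

/-!
# Ring 2 — hypotheses layer, descent axis: `G(A^{r+1}) = G(A)` ACTING DIAGONALLY — ONE THEOREM FOR EVERY PULL-BACK–STABLE SYSTEM OF
# CLASSES ON ABELIAN VARIETIES WHOSE STABILISER LIES IN MILNE'S `S` (part 1 of 3: the generic theorem and the transfer of inclusions)

HONEST FRAMING (page 1, verbatim the cell's standing line): **research route conditional on HC_CM; not a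
corollary; Q11.4-sentence-2 already refuted in dim ≥ 3.** Nothing in this file proves a case of the Hodge conjecture;
nothing discharges the binder of record b06 `Ring2.Hypotheses.AbsoluteHodgeImpliesAlgebraicAV` («absolute Hodge classes
on complex abelian varieties are algebraic», `Ring2HypothesesDescent.lean` :73; OPEN); the binder table's numbers do not
move. `HC_CM` (`Theses.RankFourFaces.CMAbelianHodge`), `HC_AV` and row b06 are ABSENT from this file. Hodge ladder STAGE 3,
`BINDER-OWNERS.md` row **b06**, seat `ring2-b06` (gen 86). It closes the item the Literature file `Milne1999/HodgeGroupPowersDiagonal`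
(Moonen–Zarhin `Hg(A^{r+1}) = Hg(A)`, gen 85) lists under "What is NOT here": «the analogous statements for André's `G¹_mot`, the
absolute Hodge stabiliser and the algebraic stabiliser (same proof given the pull-back stability of those classes)» — uniformly.
Companions: `…ExteriorStabilizerPowersTower` (the five systems of the tower are admissible; `S`, `G¹_alg`, `G¹_mot`, `G¹_AH` on the
powers) and `…ExteriorStabilizerPowersPrices` (power-invariance of the prices of the dictionary).

THE SETTING. A «class notion» is any `P : (N : ℕ) → (Y : SchemeOver ℂ) → (p : ℕ) → Set H²ᵖ(Y(ℂ); ℂ)` (classes of codimension `p`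
on an `N`-dimensional `Y`); its SYSTEM ON THE POWERS of a complex abelian variety `B` is
`a p ↦ P ((a+1) dim B) (B.X^{×(a+1)}) p` (`cartesianPowDim`, `cartesianPow` of `HodgeTheory/MotivatedGaloisGroup`), and its GROUP is
the stabiliser `G_P(B) := powClassStabilizer B.X (that system)` — the `g ∈ ∏ₖ GL(Hᵏ(B(ℂ); ℂ))` whose Künneth extension fixes every
`P`-class of every power. Instances, ON THE NOSE: `P` = Lefschetz classes `divisorClassesSpan` ↦ Milne's `S(B) = specialLefschetzGroup`;
rational `(p,p)`-classes ↦ `Hg(B) = hodgeGroup`; absolute Hodge classes ↦ `G¹_AH(B)` (gen 81, inline); André's `motivatedClasses` ↦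
`G¹_mot(B) = specialMotivatedGaloisGroup`; `algebraicClasses` ↦ typer 2's `G¹_alg(B) = algebraicStabilizer`. Call `P` ADMISSIBLE when
(S) `G_P(B) ≤ S(B)` for the abelian varieties `B` at hand, and (Π) `P` is stable under pull-back along every homomorphism of complex
abelian varieties — two DISPLAYED hypotheses `hS`, `hP` on a variable `P` (no definition).

* (namespace `StabilizerPowers`) **FOR EVERY ADMISSIBLE `P`: `G_P(A^{r+1}) = G_P(A)` ACTING DIAGONALLY** (`mem_powSucc_iff`):
  a family `g'` of automorphisms of the `Hᵏ(A^{r+1}(ℂ); ℂ)` lies in `G_P(A^{r+1})` iff `g' = ⋀•(g₁^{⊕(r+1)})`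
  (`Milne1999.diagPowExterior A (g 1) r`) for a — unique, `eq_of_diagPowExterior_eq` — `g ∈ G_P(A)`; on `H¹`:
  `G_P(A^{r+1})|_{H¹} = {u^{⊕(r+1)} | u ∈ G_P(A)|_{H¹}}` (`mem_map_evalOne_powSucc_iff`); `g ↦ ⋀•(g₁^{⊕(r+1)})` is a BIJECTION
  `G_P(A) → G_P(A^{r+1})` (`bijOn_powSucc`). PROOF = the retraction method of `Milne1999/HodgeGroupPowersDiagonal` verbatim: by (S)
  every `g ∈ G_P(B)` acts through `H¹` (`g = ⋀•(g₁)`, gen 85's `specialLefschetzGroup_eq_exteriorPullbackEquiv`) with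
  `g₁ ∈ C(B) ⊗ ℂ` (the Milne lane's `specialLefschetzGroup_map_one_le_centralizerGroup`), `C(A^{r+1}) = C(A)` diagonally
  (`exists_eq_diagPow_of_mem_centralizerGroup`), every homomorphism between powers intertwines the diagonal `C(A)`-actions
  (`diagPow_map_powSucc_powSucc`, `diagPow_powSucc_map_powSucc`), `A^{a+1} ⊂ (A^{r+1})^{a+1} ⊂ A^{N+1}` are retracts by homomorphisms
  (`exists_retraction_…`), `P`-classes pull back by (Π), and a retraction is injective on cohomology.
* **TRANSFER** (`le_powSucc_iff`, `eq_powSucc_iff`): for admissible `P`, `Q`, `G_P(A) ≤ G_Q(A) ⟺ G_P(A^{r+1}) ≤ G_Q(A^{r+1})` and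
  likewise for `=` — every inclusion / equality between groups of the Tannaka-free tower is POWER-INVARIANT.

HONEST COLUMN. No definition, no named fact, no sorry; no fact of record is displayed in THIS file (the hypotheses are the abstract
`hS hP`); nothing of the cell is discharged. NOT obtained: products of non-isogenous factors (`G(A × B)` vs `G(A) × G(B)` — false for
`Hg` in general, Milne's theorem for `S`); the similitude / `L(A)` / `MT` versions; anything deciding the row. PRESEARCH: [corpus:
paper:doi-10-1007-bf02698643 (André 1996) p. 31 = held p0028 L14–L22, re-read this session («`G(A)` … est le sous-groupe algébrique
réductif de `GL H¹(A)` qui fixe les cycles algébriques parmi les tenseurs mixtes sur `H¹(A)`»; «En remplaçant `A` par ses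
puissances»); paper:doi-10-1215-s0012-7094-99-09620-5 (Milne 1999) §1 p. 643, Cor. 4.7; Moonen–Zarhin 1999 §1 as quoted in
`Milne1999/HodgeGroupPowersDiagonal`]; corpus hybrid / vector «motivic Galois group of a power of an abelian variety, diagonal» →
Green–Griffiths–Kerr, Carlson–Müller-Stach–Peters, LNM 900 (Tannakian folklore `⟨h(Aʳ)⟩^⊗ = ⟨h(A)⟩^⊗`); galaxy all stars «acting
diagonally|motivic Galois group of|Hodge group of a power» → noise only ⇒ certification by assembly on the tree's carriers, no novelty
claimed. References (bib keys): Milne1999LefschetzClasses (§1 p. 643, Def. 4.3, Thm. 4.4, Cor. 4.7), MoonenZarhin1999LowDim (§1),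
Andre1996Motifs (§4.6 (ii), §6.2–6.3), Deligne1982HodgeCycles (I §3 Prop. 3.4, Thm. 3.8), vanGeemen1994HodgeAV (6.4–6.5),
LangeBirkenhake1992 (Thm. 4.2.1, Lemma 1.1.17), HatcherAT2002 (§3.2 Thm. 3.16).
-/

noncomputable section

-- every declaration of this problem lives in `Summit.HodgeConjecture.HodgeConjecture.…` (summit = sub-problem)
set_option linter.dupNamespace false

namespace Summit.HodgeConjecture.HodgeConjecture.Ring2.Hypotheses

open CategoryTheory AlgebraicGeometry MonoidalCategory CartesianMonoidalCategory
open Literature.AlgebraicGeometry Literature.AlgebraicGeometry.Motives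
open Literature.AlgebraicGeometry.HodgeTheory
open Literature.AlgebraicTopology.SingularHomology
open Literature.Barriers.HodgeConjecture (divisorClassesSpan)
open Literature.AlgebraicGeometry.Milne1999 (specialLefschetzGroup lefschetzPowClasses centralizerGroup diagPow diagPowExterior
  exteriorKunnethFamily exteriorPullbackEquiv castAut)

/-! ## §0 The generic theorem: `G_P(A^{r+1}) = G_P(A)` diagonally for every admissible class notion `P` -/

namespace StabilizerPowers

variable {P Q : ∀ (_N : ℕ) (Y : SchemeOver ℂ) (p : ℕ), Set (complexBetti Y (2 * p))}

/-- Transport «fixes every `P`-class», cartesian power → abelian variety, along `Y = Y'`, `N = N'` (private plumbing, by `subst`;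
cf. the private lemmas of `Milne1999/HodgeGroupPowersDiagonal`). [folklore] -/
private theorem apply_eq_self_of_castAut {Y Y' : SchemeOver ℂ} (e : Y = Y') {N N' : ℕ} (hN : N = N')
    (G : ∀ k : ℕ, complexBetti Y k ≃ₗ[ℂ] complexBetti Y k)
    (h : ∀ (p : ℕ) (x : complexBetti Y' (2 * p)), x ∈ P N' Y' p → castAut e G (2 * p) x = x)
    (p : ℕ) (c : complexBetti Y (2 * p)) (hc : c ∈ P N Y p) : G (2 * p) c = c := by
  subst e hN
  exact h p c hc

/-- Transport «fixes every `P`-class», abelian variety → cartesian power (private plumbing, by `subst`). [folklore] -/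
private theorem castAut_apply_eq_self_of {Y Y' : SchemeOver ℂ} (e : Y = Y') {N N' : ℕ} (hN : N = N')
    (G : ∀ k : ℕ, complexBetti Y k ≃ₗ[ℂ] complexBetti Y k)
    (h : ∀ (p : ℕ) (c : complexBetti Y (2 * p)), c ∈ P N Y p → G (2 * p) c = c)
    (p : ℕ) (x : complexBetti Y' (2 * p)) (hx : x ∈ P N' Y' p) : castAut e G (2 * p) x = x := by
  subst e hN
  exact h p x hx

section Fixes

variable {A : AbelianVariety ℂ} {g : ∀ k : ℕ, complexBetti A.X k ≃ₗ[ℂ] complexBetti A.X k}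

/-- **For `g ∈ G_P(A)` with `G_P(A) ≤ S(A)`: `⋀•(g₁^{⊕(a+1)})` fixes every `P`-class of the abelian variety `A^{a+1}`** — the
Künneth family of `g` is `⋀•(g₁^{⊕(a+1)})` (`S(A)` acts diagonally through `H¹`, gen 85's `kunnethFamily_eq_exteriorKunnethFamily`),
read on `(A^{a+1}).X = A.X^{×(a+1)}`. [cite: Milne1999LefschetzClasses, Def. 4.3 and §4 p. 658]
[cite: Deligne1982HodgeCycles, I §3 (before Thm. 3.8)] -/
theorem diagPowExterior_apply_eq_self
    (hS : powClassStabilizer A.X (fun a p ↦ P (cartesianPowDim A.dim a) (cartesianPow A.X (a + 1)) p) ≤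
      specialLefschetzGroup A.dim A.X)
    (hg : g ∈ powClassStabilizer A.X (fun a p ↦ P (cartesianPowDim A.dim a) (cartesianPow A.X (a + 1)) p)) (a p : ℕ)
    {c : complexBetti (A.powSucc a).X (2 * p)} (hc : c ∈ P (A.powSucc a).dim (A.powSucc a).X p) :
    diagPowExterior A (g 1) a (2 * p) c = c := by
  obtain ⟨G, hG, h0, hfix⟩ := hg
  have hGeq : G = exteriorKunnethFamily A (g 1) := kunnethFamily_eq_exteriorKunnethFamily (hS ⟨G, hG, h0, hfix⟩) hG h0
  refine apply_eq_self_of_castAut (A.powSucc_X_eq_cartesianPow a) (A.dim_powSucc_eq_cartesianPowDim a)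
    (diagPowExterior A (g 1) a) (fun q x hx ↦ ?_) p c hc
  have e := hfix a q x hx
  rwa [hGeq] at e

/-- **Conversely**: if `⋀•(u^{⊕(a+1)})` fixes every `P`-class of every `A^{a+1}`, then `(⋀ᵏu)_k ∈ G_P(A)` (its Künneth family is the
lane's `exteriorKunnethFamily A u`). No hypothesis on `P`. [cite: Milne1999LefschetzClasses, Def. 4.3] [cite: Deligne1982HodgeCycles, I §3 (before Thm. 3.8)] -/
theorem exteriorPullbackEquiv_mem_of_forall {u : complexBetti A.X 1 ≃ₗ[ℂ] complexBetti A.X 1}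
    (h : ∀ (a p : ℕ) (c : complexBetti (A.powSucc a).X (2 * p)), c ∈ P (A.powSucc a).dim (A.powSucc a).X p →
      diagPowExterior A u a (2 * p) c = c) :
    (fun k ↦ exteriorPullbackEquiv (AbelianVariety.hasExteriorCohomologyH1_complexPoints A) u k) ∈
      powClassStabilizer A.X (fun a p ↦ P (cartesianPowDim A.dim a) (cartesianPow A.X (a + 1)) p) :=
  ⟨exteriorKunnethFamily A u, Milne1999.isKunnethFamily_exteriorKunnethFamily A u, Milne1999.exteriorKunnethFamily_zero A u,
    fun a p x hx ↦ castAut_apply_eq_self_of (A.powSucc_X_eq_cartesianPow a) (A.dim_powSucc_eq_cartesianPowDim a)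
      (diagPowExterior A u a) (h a) p x hx⟩

/-- For `g ∈ G_P(A) ≤ S(A)`: `g = (⋀ᵏ(g₁))_k` and `g₁ ∈ C(A) ⊗ ℂ` (gen 85's `specialLefschetzGroup_eq_exteriorPullbackEquiv` and the
Milne lane's `specialLefschetzGroup_map_one_le_centralizerGroup`). [cite: Milne1999LefschetzClasses, Thm. 4.4 and §1 p. 642] -/
theorem eq_exteriorPullbackEquiv_and_mem_centralizerGroup
    (hS : powClassStabilizer A.X (fun a p ↦ P (cartesianPowDim A.dim a) (cartesianPow A.X (a + 1)) p) ≤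
      specialLefschetzGroup A.dim A.X)
    (hg : g ∈ powClassStabilizer A.X (fun a p ↦ P (cartesianPowDim A.dim a) (cartesianPow A.X (a + 1)) p)) :
    (g = fun k ↦ exteriorPullbackEquiv (AbelianVariety.hasExteriorCohomologyH1_complexPoints A) (g 1) k) ∧
      g 1 ∈ centralizerGroup A :=
  ⟨specialLefschetzGroup_eq_exteriorPullbackEquiv (hS hg),
    Milne1999.specialLefschetzGroup_map_one_le_centralizerGroup A (Subgroup.mem_map_of_mem _ (hS hg))⟩

/-- **Uniqueness**: two elements of `G_P(A)` with the same diagonal `⋀•(g₁^{⊕(r+1)})` are equal (`u ↦ u^{⊕(r+1)}` is injective,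
`diagPow_injective`; `g ↦ g₁` is injective on `S(A) ⊇ G_P(A)`, gen 85's `specialLefschetzGroup_ext_one`).
[cite: Milne1999LefschetzClasses, §1 p. 643 and Thm. 4.4] -/
theorem eq_of_diagPowExterior_eq
    (hS : powClassStabilizer A.X (fun a p ↦ P (cartesianPowDim A.dim a) (cartesianPow A.X (a + 1)) p) ≤
      specialLefschetzGroup A.dim A.X)
    {r : ℕ} {k : ∀ i : ℕ, complexBetti A.X i ≃ₗ[ℂ] complexBetti A.X i}
    (hg : g ∈ powClassStabilizer A.X (fun a p ↦ P (cartesianPowDim A.dim a) (cartesianPow A.X (a + 1)) p))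
    (hk : k ∈ powClassStabilizer A.X (fun a p ↦ P (cartesianPowDim A.dim a) (cartesianPow A.X (a + 1)) p))
    (h : diagPowExterior A (g 1) r = diagPowExterior A (k 1) r) : g = k := by
  have h1 : diagPow A (g 1) r = diagPow A (k 1) r := by
    have e := congrArg (fun G : ∀ i : ℕ, complexBetti (A.powSucc r).X i ≃ₗ[ℂ] complexBetti (A.powSucc r).X i ↦ G 1) h
    simpa only [Milne1999.diagPowExterior, Milne1999.exteriorPullbackEquiv_one_eq] using e
  exact specialLefschetzGroup_ext_one (hS hg) (hS hk) (Milne1999.diagPow_injective (A := A) r h1)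

end Fixes

section Main

variable (hS : ∀ B : AbelianVariety ℂ,
    powClassStabilizer B.X (fun a p ↦ P (cartesianPowDim B.dim a) (cartesianPow B.X (a + 1)) p) ≤ specialLefschetzGroup B.dim B.X)
  (hP : ∀ ⦃B B' : AbelianVariety ℂ⦄ (f : B ⟶ B') ⦃p : ℕ⦄ ⦃c : complexBetti B'.X (2 * p)⦄,
    c ∈ P B'.dim B'.X p → complexBetti.map f.hom.hom.hom (2 * p) c ∈ P B.dim B.X p)
include hS hP

/-- **`⊇`: the diagonal of `G_P(A)` lies in `G_P(A^{r+1})`** (admissible `P`). For `g ∈ G_P(A)` the family `⋀•(g₁^{⊕(r+1)})` on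
`H•(A^{r+1}(ℂ); ℂ)` lies in `G_P(A^{r+1})`: its Künneth family `⋀•((g₁^{⊕(r+1)})^{⊕(a+1)})` fixes every `P`-class `c` of
`(A^{r+1})^{a+1}` — pull `c` back along a retraction `π' : A^{N+1} → (A^{r+1})^{a+1}`, where `⋀•(g₁^{⊕(N+1)})` fixes it, use that `π'^*`
intertwines and is injective. [cite: MoonenZarhin1999LowDim, §1] [cite: Milne1999LefschetzClasses, §1 p. 643]
[cite: Andre1996Motifs, §6.2 (p. 31)] -/
theorem diagPowExterior_mem_powSucc {A : AbelianVariety ℂ} {g : ∀ k : ℕ, complexBetti A.X k ≃ₗ[ℂ] complexBetti A.X k}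
    (hg : g ∈ powClassStabilizer A.X (fun a p ↦ P (cartesianPowDim A.dim a) (cartesianPow A.X (a + 1)) p)) (r : ℕ) :
    diagPowExterior A (g 1) r ∈ powClassStabilizer (A.powSucc r).X
      (fun a p ↦ P (cartesianPowDim (A.powSucc r).dim a) (cartesianPow (A.powSucc r).X (a + 1)) p) := by
  have hC : g 1 ∈ centralizerGroup A := (eq_exteriorPullbackEquiv_and_mem_centralizerGroup (hS A) hg).2
  -- `⋀•((g₁^{⊕(r+1)})^{⊕(a+1)})` fixes the `P`-classes of every `(A^{r+1})^{a+1}`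
  have key : ∀ (a p : ℕ) (c : complexBetti ((A.powSucc r).powSucc a).X (2 * p)),
      c ∈ P ((A.powSucc r).powSucc a).dim ((A.powSucc r).powSucc a).X p →
        diagPowExterior (A.powSucc r) (diagPow A (g 1) r) a (2 * p) c = c := by
    intro a p c hc
    obtain ⟨N, ι', π', hιπ⟩ := Milne1999.exists_retraction_powSucc_powSucc_powSucc A r a
    -- `π'^* c` is a `P`-class of `A^{N+1}`, fixed by `⋀•(g₁^{⊕(N+1)})`
    have hfix := diagPowExterior_apply_eq_self (hS A) hg N p (hP π' hc)
    rw [Milne1999.diagPowExterior, Milne1999.exteriorPullbackEquiv_apply,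
      Milne1999.exteriorPullback_map_of_intertwine π' (diagPow A (g 1) N).toLinearMap
        (diagPow (A.powSucc r) (diagPow A (g 1) r) a).toLinearMap
        (fun y ↦ Milne1999.diagPow_map_powSucc_powSucc hC r N a π' y)] at hfix
    have e := congrArg (complexBetti.map ι'.hom.hom.hom (2 * p)) hfix
    rwa [Milne1999.map_map_of_comp_eq_id hιπ, Milne1999.map_map_of_comp_eq_id hιπ,
      ← Milne1999.exteriorPullbackEquiv_apply] at e
  exact exteriorPullbackEquiv_mem_of_forall key

/-- **`⊆`: every element of `G_P(A^{r+1})` is `⋀•(g₁^{⊕(r+1)})` for a `g ∈ G_P(A)`** (admissible `P`). `g'` acts through `H¹(A^{r+1})`,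
`g'₁ ∈ C(A^{r+1}) = C(A)^{diag}`, so `g' = ⋀•(u^{⊕(r+1)})` with `u ∈ C(A) ⊗ ℂ`; and `(⋀ᵏu)_k ∈ G_P(A)`: its Künneth family fixes every
`P`-class `c` of `A^{a+1}` — pull `c` back along a retraction `π : (A^{r+1})^{a+1} → A^{a+1}`, where the Künneth family of `g'` fixes it,
and come back. [cite: MoonenZarhin1999LowDim, §1] [cite: Milne1999LefschetzClasses, §1 p. 643 and Cor. 4.7]
[cite: Andre1996Motifs, §6.2 (p. 31)] -/
theorem exists_mem_of_mem_powSucc (A : AbelianVariety ℂ) (r : ℕ)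
    {g' : ∀ k : ℕ, complexBetti (A.powSucc r).X k ≃ₗ[ℂ] complexBetti (A.powSucc r).X k}
    (hg' : g' ∈ powClassStabilizer (A.powSucc r).X
      (fun a p ↦ P (cartesianPowDim (A.powSucc r).dim a) (cartesianPow (A.powSucc r).X (a + 1)) p)) :
    ∃ g ∈ powClassStabilizer A.X (fun a p ↦ P (cartesianPowDim A.dim a) (cartesianPow A.X (a + 1)) p),
      diagPowExterior A (g 1) r = g' := by
  -- `g'₁ ∈ C(A^{r+1}) = C(A)` diagonally
  obtain ⟨hg'eq₀, h1⟩ := eq_exteriorPullbackEquiv_and_mem_centralizerGroup (hS (A.powSucc r)) hg'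
  obtain ⟨u, hu, huU⟩ := Milne1999.exists_eq_diagPow_of_mem_centralizerGroup r (g' 1) h1
  have hg'eq : g' = diagPowExterior A u r := by
    rw [hg'eq₀, ← huU]
    rfl
  -- `(⋀ᵏu)_k ∈ G_P(A)`: `⋀•(u^{⊕(a+1)})` fixes the `P`-classes of every `A^{a+1}`
  have key : ∀ (a p : ℕ) (c : complexBetti (A.powSucc a).X (2 * p)), c ∈ P (A.powSucc a).dim (A.powSucc a).X p →
      diagPowExterior A u a (2 * p) c = c := by
    intro a p c hc
    obtain ⟨ι, π, hιπ⟩ := Milne1999.exists_retraction_powSucc_powSucc A r a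
    -- `π^* c` is a `P`-class of `(A^{r+1})^{a+1}`, fixed by the Künneth family `⋀•((u^{⊕(r+1)})^{⊕(a+1)})` of `g'`
    have hfix := diagPowExterior_apply_eq_self (hS (A.powSucc r)) hg' a p (hP π hc)
    rw [← huU, Milne1999.diagPowExterior, Milne1999.exteriorPullbackEquiv_apply,
      Milne1999.exteriorPullback_map_of_intertwine π (diagPow (A.powSucc r) (diagPow A u r) a).toLinearMap
        (diagPow A u a).toLinearMap (fun y ↦ Milne1999.diagPow_powSucc_map_powSucc hu r a a π y)] at hfix
    have e := congrArg (complexBetti.map ι.hom.hom.hom (2 * p)) hfix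
    rwa [Milne1999.map_map_of_comp_eq_id hιπ, Milne1999.map_map_of_comp_eq_id hιπ,
      ← Milne1999.exteriorPullbackEquiv_apply] at e
  refine ⟨fun k ↦ exteriorPullbackEquiv (AbelianVariety.hasExteriorCohomologyH1_complexPoints A) u k,
    exteriorPullbackEquiv_mem_of_forall key, ?_⟩
  rw [hg'eq]
  dsimp only
  rw [Milne1999.exteriorPullbackEquiv_one_eq]

/-- **`G_P(A^{r+1}) = G_P(A)` ACTING DIAGONALLY, for every admissible class notion `P`**: a family `g'` of automorphisms of the
`Hᵏ(A^{r+1}(ℂ); ℂ)` lies in the stabiliser of the `P`-classes on the powers of `A^{r+1}` iff `g' = ⋀•(g₁^{⊕(r+1)})`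
(`Milne1999.diagPowExterior A (g 1) r`) for some — unique, `eq_of_diagPowExterior_eq` — `g` in the stabiliser of the `P`-classes on the
powers of `A` («we can identify `G(Xⁿ)` with `G(X)`, acting diagonally»). [cite: MoonenZarhin1999LowDim, §1]
[cite: Milne1999LefschetzClasses, §1 p. 643 and Cor. 4.7] [cite: Andre1996Motifs, §6.2–6.3 (p. 31)] -/
theorem mem_powSucc_iff (A : AbelianVariety ℂ) (r : ℕ)
    (g' : ∀ k : ℕ, complexBetti (A.powSucc r).X k ≃ₗ[ℂ] complexBetti (A.powSucc r).X k) :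
    g' ∈ powClassStabilizer (A.powSucc r).X
        (fun a p ↦ P (cartesianPowDim (A.powSucc r).dim a) (cartesianPow (A.powSucc r).X (a + 1)) p) ↔
      ∃ g ∈ powClassStabilizer A.X (fun a p ↦ P (cartesianPowDim A.dim a) (cartesianPow A.X (a + 1)) p),
        diagPowExterior A (g 1) r = g' :=
  ⟨exists_mem_of_mem_powSucc hS hP A r, fun ⟨_, hg, e⟩ ↦ e ▸ diagPowExterior_mem_powSucc hS hP hg r⟩

/-- **On `H¹`: `G_P(A^{r+1})|_{H¹} = {u^{⊕(r+1)} | u ∈ G_P(A)|_{H¹}}`** — the diagonal embedding `u ↦ u^{⊕(r+1)}` (`Milne1999.diagPow`)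
carries the image of `G_P(A)` in `GL(H¹(A(ℂ); ℂ))` ONTO the image of `G_P(A^{r+1})` in `GL(H¹(A^{r+1}(ℂ); ℂ))`.
[cite: MoonenZarhin1999LowDim, §1] [cite: Milne1999LefschetzClasses, §1 p. 643] [cite: Andre1996Motifs, §6.2 (p. 31)] -/
theorem mem_map_evalOne_powSucc_iff (A : AbelianVariety ℂ) (r : ℕ)
    (U : complexBetti (A.powSucc r).X 1 ≃ₗ[ℂ] complexBetti (A.powSucc r).X 1) :
    U ∈ (powClassStabilizer (A.powSucc r).X
        (fun a p ↦ P (cartesianPowDim (A.powSucc r).dim a) (cartesianPow (A.powSucc r).X (a + 1)) p)).map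
        (Pi.evalMonoidHom (fun k : ℕ ↦ complexBetti (A.powSucc r).X k ≃ₗ[ℂ] complexBetti (A.powSucc r).X k) 1) ↔
      ∃ u ∈ (powClassStabilizer A.X (fun a p ↦ P (cartesianPowDim A.dim a) (cartesianPow A.X (a + 1)) p)).map
        (Pi.evalMonoidHom (fun k : ℕ ↦ complexBetti A.X k ≃ₗ[ℂ] complexBetti A.X k) 1), diagPow A u r = U := by
  constructor
  · intro hU
    obtain ⟨g', hg', rfl⟩ := Subgroup.mem_map.1 hU
    obtain ⟨g, hg, rfl⟩ := exists_mem_of_mem_powSucc hS hP A r hg'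
    exact ⟨g 1, Subgroup.mem_map_of_mem _ hg, (Milne1999.exteriorPullbackEquiv_one_eq _ _).symm⟩
  · rintro ⟨u, hu, rfl⟩
    obtain ⟨g, hg, rfl⟩ := Subgroup.mem_map.1 hu
    exact Subgroup.mem_map.2 ⟨_, diagPowExterior_mem_powSucc hS hP hg r, Milne1999.exteriorPullbackEquiv_one_eq _ _⟩

/-- **`g ↦ ⋀•(g₁^{⊕(r+1)})` is a BIJECTION `G_P(A) → G_P(A^{r+1})`** (admissible `P`): «`G(Aʳ) = G(A)`» as an identification of
groups, on the tree's carriers. [cite: MoonenZarhin1999LowDim, §1] [cite: Milne1999LefschetzClasses, Cor. 4.7]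
[cite: Andre1996Motifs, §6.2 (p. 31)] -/
theorem bijOn_powSucc (A : AbelianVariety ℂ) (r : ℕ) :
    Set.BijOn (fun g : ∀ k : ℕ, complexBetti A.X k ≃ₗ[ℂ] complexBetti A.X k ↦ diagPowExterior A (g 1) r)
      (powClassStabilizer A.X (fun a p ↦ P (cartesianPowDim A.dim a) (cartesianPow A.X (a + 1)) p))
      (powClassStabilizer (A.powSucc r).X
        (fun a p ↦ P (cartesianPowDim (A.powSucc r).dim a) (cartesianPow (A.powSucc r).X (a + 1)) p)) :=
  ⟨fun _ hg ↦ diagPowExterior_mem_powSucc hS hP hg r, fun _ hg _ hk h ↦ eq_of_diagPowExterior_eq (hS A) hg hk h,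
    fun _ hg' ↦ exists_mem_of_mem_powSucc hS hP A r hg'⟩

variable (hS' : ∀ B : AbelianVariety ℂ,
    powClassStabilizer B.X (fun a p ↦ Q (cartesianPowDim B.dim a) (cartesianPow B.X (a + 1)) p) ≤ specialLefschetzGroup B.dim B.X)
  (hQ : ∀ ⦃B B' : AbelianVariety ℂ⦄ (f : B ⟶ B') ⦃p : ℕ⦄ ⦃c : complexBetti B'.X (2 * p)⦄,
    c ∈ Q B'.dim B'.X p → complexBetti.map f.hom.hom.hom (2 * p) c ∈ Q B.dim B.X p)
include hS' hQ

/-- **TRANSFER OF INCLUSIONS: `G_P(A) ≤ G_Q(A) ⟺ G_P(A^{r+1}) ≤ G_Q(A^{r+1})`** for admissible `P`, `Q` — both groups of the power are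
the diagonal images of the groups of `A` under the same injective map. Every inclusion of the Tannaka-free tower is POWER-INVARIANT.
[cite: MoonenZarhin1999LowDim, §1] [cite: Andre1996Motifs, §6.2–6.3 (p. 31)] -/
theorem le_powSucc_iff (A : AbelianVariety ℂ) (r : ℕ) :
    powClassStabilizer (A.powSucc r).X
        (fun a p ↦ P (cartesianPowDim (A.powSucc r).dim a) (cartesianPow (A.powSucc r).X (a + 1)) p) ≤
      powClassStabilizer (A.powSucc r).X
        (fun a p ↦ Q (cartesianPowDim (A.powSucc r).dim a) (cartesianPow (A.powSucc r).X (a + 1)) p) ↔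
    powClassStabilizer A.X (fun a p ↦ P (cartesianPowDim A.dim a) (cartesianPow A.X (a + 1)) p) ≤
      powClassStabilizer A.X (fun a p ↦ Q (cartesianPowDim A.dim a) (cartesianPow A.X (a + 1)) p) := by
  constructor
  · intro h g hg
    obtain ⟨k, hk, hkg⟩ := exists_mem_of_mem_powSucc hS' hQ A r (h (diagPowExterior_mem_powSucc hS hP hg r))
    -- `k, g ∈ S(A)` with the same diagonal: `k = g`
    have h1 : diagPow A (k 1) r = diagPow A (g 1) r := by
      have e := congrArg (fun G : ∀ i : ℕ, complexBetti (A.powSucc r).X i ≃ₗ[ℂ] complexBetti (A.powSucc r).X i ↦ G 1) hkg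
      simpa only [Milne1999.diagPowExterior, Milne1999.exteriorPullbackEquiv_one_eq] using e
    rwa [← specialLefschetzGroup_ext_one (hS' A hk) (hS A hg) (Milne1999.diagPow_injective (A := A) r h1)]
  · intro h g' hg'
    obtain ⟨g, hg, rfl⟩ := exists_mem_of_mem_powSucc hS hP A r hg'
    exact diagPowExterior_mem_powSucc hS' hQ (h hg) r

/-- **TRANSFER OF EQUALITIES: `G_P(A) = G_Q(A) ⟺ G_P(A^{r+1}) = G_Q(A^{r+1})`** for admissible `P`, `Q`.
[cite: MoonenZarhin1999LowDim, §1] [cite: Andre1996Motifs, §6.2–6.3 (p. 31)] -/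
theorem eq_powSucc_iff (A : AbelianVariety ℂ) (r : ℕ) :
    powClassStabilizer (A.powSucc r).X
        (fun a p ↦ P (cartesianPowDim (A.powSucc r).dim a) (cartesianPow (A.powSucc r).X (a + 1)) p) =
      powClassStabilizer (A.powSucc r).X
        (fun a p ↦ Q (cartesianPowDim (A.powSucc r).dim a) (cartesianPow (A.powSucc r).X (a + 1)) p) ↔
    powClassStabilizer A.X (fun a p ↦ P (cartesianPowDim A.dim a) (cartesianPow A.X (a + 1)) p) =
      powClassStabilizer A.X (fun a p ↦ Q (cartesianPowDim A.dim a) (cartesianPow A.X (a + 1)) p) := by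
  rw [le_antisymm_iff, le_antisymm_iff, le_powSucc_iff hS hP hS' hQ A r, le_powSucc_iff hS' hQ hS hP A r]

end Main

end StabilizerPowers

end Summit.HodgeConjecture.HodgeConjecture.Ring2.Hypotheses

end
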